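import Mathlib
import Summits.ValiantsHypothesis.ValiantsHypothesis.Theorems.NewtonUnitEquationsDissociatedUniformTotalsLaw
import Summits.ValiantsHypothesis.ValiantsHypothesis.Theorems.NewtonUnitEquationsDissociatedUniformTotalsLawShares
import Summits.ValiantsHypothesis.ValiantsHypothesis.Theorems.NewtonUnitEquationsDissociatedUniformTotalsLawChartTops
import Literature.Computability.AlgebraicComplexity.NewtonPolygonTauProductBounds
import HarnessLib

/-!
# Crux `NewtonUnitEquations.DissociatedUniform` (stmt-ValiantsHypothesis-5905): totals law — chart geometry of a finite curve (margins)

Quantitative chart geometry feeding the separated ("third curve dominant") regime of the `n = 3` totals law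
(memo `Cruxes/DissociatedUniform/NOTES-d1g3.md` §2 L5; `NOTES-t1.md` D7/§5(i)).  Along a half-chart `w = (σ, t)`, `σ = ±1`,
for a finite planar set `F` (the third curve `C = c(G)`):
* `tieTimes σ F` — the finite set of times at which two points of `F` with different second coordinates tie;
* `exists_gap` — a finite set of reals has a positive separation constant;
* `far_margin` — at a time `ε`-far from every tie time, `F` has a strict top beating every other point by `≥ min κ₀ (ε κ₁)`
  (`κ₀`, `κ₁` = separation constants of the two coordinates);
* `near_margin` / `isStrictTop_near` — within `ε` of a time `u`, every maximiser at `u` still beats every non-maximiser by half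
  the gap at `u` (when `ε Λ ≤ gap/2`, `Λ` = spread of second coordinates); a unique maximiser stays the strict top;
* `end_margin_top` / `end_margin_bot` — beyond `|t| > T ≥ 1 + 2Λ/κ₁` the highest (lowest) points beat the rest by `≥ |t| κ₁ / 2`;
* `isStrictTop_between_of_max` — a point maximal at two times is the strict top strictly in between (so a position is a tied
  maximiser at no more than two tie times: `sum_card_maxSet_le`);
* `bandWidth_le`, `qual_of_isStrictTop` — the winning-position inequality of `…TotalsLawShares` for a scaled curve `μ • c`:
  an exposed class word at position `z` forces `μ · (⟨w, c z'⟩ - ⟨w, c z⟩) ≤ bandWidth ≤ (|w₀|+|w₁|)·R_{ab}` for all `z'`.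
One definition with a body (`tieTimes`); no named facts; nothing here bears on the law itself (OPEN) or on `VP ≠ VNP`.
[folklore]
-/

set_option linter.dupNamespace false -- `ValiantsHypothesis.ValiantsHypothesis` (summit = problem) in every name

open scoped BigOperators
open Matrix Finset

namespace Summit.ValiantsHypothesis.ValiantsHypothesis.Theorems.NewtonUnitEquationsDissociatedUniform

namespace TotalsLaw

open Literature.Computability.AlgebraicComplexity.KPTT.PlanarMinkowski

/-! ### Tie times and separation constants -/

/-- The tie times of a finite planar set `F` along the half-chart `σ`: the times `-(σ (p₀ - q₀)) / (p₁ - q₁)` at which two points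
`p, q ∈ F` with `p₁ ≠ q₁` have equal weight `⟨(σ, t), ·⟩` (the form used by `card_chartTops_le_card_ties_add_one`). -/
noncomputable def tieTimes (σ : ℝ) (F : Finset (Fin 2 → ℝ)) : Finset ℝ :=
  ((F ×ˢ F).filter fun p => p.1 1 ≠ p.2 1).image fun p => -(σ * (p.1 0 - p.2 0)) / (p.1 1 - p.2 1)

/-- Two points with different second coordinates tie at their tie time, which belongs to `tieTimes`. [folklore] -/
theorem tie_mem_tieTimes {σ : ℝ} {F : Finset (Fin 2 → ℝ)} {x y : Fin 2 → ℝ} (hx : x ∈ F) (hy : y ∈ F) (h : x 1 ≠ y 1) :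
    -(σ * (x 0 - y 0)) / (x 1 - y 1) ∈ tieTimes σ F ∧
      ![σ, -(σ * (x 0 - y 0)) / (x 1 - y 1)] ⬝ᵥ x = ![σ, -(σ * (x 0 - y 0)) / (x 1 - y 1)] ⬝ᵥ y := by
  refine ⟨Finset.mem_image.2 ⟨(x, y), Finset.mem_filter.2 ⟨Finset.mem_product.2 ⟨hx, hy⟩, h⟩, rfl⟩, ?_⟩
  have hd : x 1 - y 1 ≠ 0 := sub_ne_zero.2 h
  rw [chart_dotProduct, chart_dotProduct]
  have : -(σ * (x 0 - y 0)) / (x 1 - y 1) * (x 1 - y 1) = -(σ * (x 0 - y 0)) := div_mul_cancel₀ _ hd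
  nlinarith [this]

/-- Equal chart weights and equal second coordinates force equal points (`σ ≠ 0`). [folklore] -/
theorem eq_of_chart_eq {σ t : ℝ} (hσ : σ ≠ 0) {x y : Fin 2 → ℝ} (h : ![σ, t] ⬝ᵥ x = ![σ, t] ⬝ᵥ y) (h1 : x 1 = y 1) :
    x = y := by
  rw [chart_dotProduct, chart_dotProduct, h1] at h
  have h0 : x 0 = y 0 := mul_left_cancel₀ hσ (by linarith)
  ext i; fin_cases i
  · exact h0
  · exact h1

/-- **Separation constant.**  A finite set of reals has a `γ > 0` below every nonzero difference of its elements. [folklore] -/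
theorem exists_gap (S : Finset ℝ) : ∃ γ : ℝ, 0 < γ ∧ ∀ τ ∈ S, ∀ τ' ∈ S, τ ≠ τ' → γ ≤ |τ - τ'| := by
  classical
  set D := ((S ×ˢ S).filter fun p => p.1 ≠ p.2).image fun p => |p.1 - p.2| with hD
  by_cases hDe : D.Nonempty
  · have hpos : 0 < D.min' hDe := by
      obtain ⟨p, hp, hpeq⟩ := Finset.mem_image.1 (D.min'_mem hDe)
      rw [← hpeq]
      exact abs_pos.2 (sub_ne_zero.2 (Finset.mem_filter.1 hp).2)
    refine ⟨D.min' hDe, hpos, fun τ hτ τ' hτ' hne => Finset.min'_le _ _ ?_⟩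
    exact Finset.mem_image.2 ⟨(τ, τ'), Finset.mem_filter.2 ⟨Finset.mem_product.2 ⟨hτ, hτ'⟩, hne⟩, rfl⟩
  · refine ⟨1, one_pos, fun τ hτ τ' hτ' hne => ?_⟩
    exact absurd ⟨|τ - τ'|, Finset.mem_image.2 ⟨(τ, τ'), Finset.mem_filter.2 ⟨Finset.mem_product.2 ⟨hτ, hτ'⟩, hne⟩,
      rfl⟩⟩ hDe

/-! ### Margins: far from the tie times, near a tie time, and at the ends of the chart -/

/-- **Far margin.**  At a time `t` that is `ε`-far from every tie time of `F`, the set `F` has a strict top `x̂`, and `x̂` beats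
every other point by at least `min κ₀ (ε κ₁)`, where `κ₀` separates the first coordinates of points with equal second coordinate
and `κ₁` separates distinct second coordinates. [folklore] -/
theorem far_margin {σ : ℝ} (hσ : σ = 1 ∨ σ = -1) (F : Finset (Fin 2 → ℝ)) (hF : F.Nonempty) {ε κ₀ κ₁ : ℝ} (hε : 0 < ε)
    (hκ₀ : ∀ x ∈ F, ∀ y ∈ F, x 1 = y 1 → x 0 ≠ y 0 → κ₀ ≤ |x 0 - y 0|)
    (hκ₁ : ∀ x ∈ F, ∀ y ∈ F, x 1 ≠ y 1 → κ₁ ≤ |x 1 - y 1|) {t : ℝ} (hfar : ∀ u ∈ tieTimes σ F, ε ≤ |t - u|) :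
    ∃ xh ∈ F, IsStrictTop ![σ, t] F xh ∧ ∀ y ∈ F, y ≠ xh → min κ₀ (ε * κ₁) ≤ ![σ, t] ⬝ᵥ xh - ![σ, t] ⬝ᵥ y := by
  have hσ0 : σ ≠ 0 := by rcases hσ with h | h <;> simp [h]
  have hσabs : |σ| = 1 := by rcases hσ with h | h <;> simp [h]
  obtain ⟨xh, hxh, hmax⟩ := F.exists_max_image (fun y => ![σ, t] ⬝ᵥ y) hF
  -- the margin over any other point
  have key : ∀ y ∈ F, y ≠ xh → 0 < ![σ, t] ⬝ᵥ xh - ![σ, t] ⬝ᵥ y ∧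
      min κ₀ (ε * κ₁) ≤ ![σ, t] ⬝ᵥ xh - ![σ, t] ⬝ᵥ y := by
    intro y hy hne
    have hge : 0 ≤ ![σ, t] ⬝ᵥ xh - ![σ, t] ⬝ᵥ y := sub_nonneg.2 (hmax y hy)
    by_cases h1 : xh 1 = y 1
    · -- equal slopes: constant advantage `σ (xh₀ - y₀) ≠ 0`
      have h0 : xh 0 ≠ y 0 := fun h0 => hne (by ext i; fin_cases i; exacts [h0.symm, h1.symm])
      have hf : ![σ, t] ⬝ᵥ xh - ![σ, t] ⬝ᵥ y = σ * (xh 0 - y 0) := by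
        rw [chart_dotProduct, chart_dotProduct, h1]; ring
      have habs : |![σ, t] ⬝ᵥ xh - ![σ, t] ⬝ᵥ y| = |xh 0 - y 0| := by rw [hf, abs_mul, hσabs, one_mul]
      have hne0 : ![σ, t] ⬝ᵥ xh - ![σ, t] ⬝ᵥ y ≠ 0 := by
        rw [hf]; exact mul_ne_zero hσ0 (sub_ne_zero.2 h0)
      have hpos : 0 < ![σ, t] ⬝ᵥ xh - ![σ, t] ⬝ᵥ y := lt_of_le_of_ne hge (Ne.symm hne0)
      refine ⟨hpos, (min_le_left _ _).trans ?_⟩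
      have := hκ₀ xh hxh y hy h1 h0
      rw [← habs, abs_of_pos hpos] at this
      exact this
    · -- different slopes: the tie time is `ε`-far
      obtain ⟨hmem, htie⟩ := tie_mem_tieTimes (σ := σ) hxh hy h1
      set u₀ := -(σ * (xh 0 - y 0)) / (xh 1 - y 1) with hu₀
      have haff := chart_dotProduct_sub_affine σ t u₀ xh y
      rw [htie, sub_self, zero_add] at haff
      have hfar' := hfar u₀ hmem
      have habs : |![σ, t] ⬝ᵥ xh - ![σ, t] ⬝ᵥ y| = |t - u₀| * |xh 1 - y 1| := by rw [haff, abs_mul]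
      have hk := hκ₁ xh hxh y hy h1
      have hne0 : ![σ, t] ⬝ᵥ xh - ![σ, t] ⬝ᵥ y ≠ 0 := by
        rw [haff]
        refine mul_ne_zero (fun h => ?_) (sub_ne_zero.2 h1)
        rw [h, abs_zero] at hfar'
        linarith
      have hpos : 0 < ![σ, t] ⬝ᵥ xh - ![σ, t] ⬝ᵥ y := lt_of_le_of_ne hge (Ne.symm hne0)
      refine ⟨hpos, (min_le_right _ _).trans ?_⟩
      rw [← abs_of_pos hpos, habs]
      by_cases hk0 : 0 ≤ κ₁
      · exact mul_le_mul hfar' hk hk0 (abs_nonneg _)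
      · push Not at hk0
        nlinarith [abs_nonneg (t - u₀), abs_nonneg (xh 1 - y 1), mul_nonneg (abs_nonneg (t - u₀)) (abs_nonneg (xh 1 - y 1))]
  exact ⟨xh, hxh, ⟨hxh, fun y hy hne => by linarith [(key y hy hne).1]⟩, fun y hy hne => (key y hy hne).2⟩

/-- **Near margin.**  If `x₁` maximises the weight at time `u` with gap `≥ g` over every non-maximiser, second coordinates of `F`
differ by at most `Λ`, and `ε Λ ≤ g / 2`, then at every time `t` with `|t - u| ≤ ε` the point `x₁` still beats every
non-maximiser by `≥ g / 2`. [folklore] -/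
theorem near_margin {σ u t ε g Λ : ℝ} {F : Finset (Fin 2 → ℝ)} {x₁ : Fin 2 → ℝ}
    (hg : ∀ y ∈ F, ![σ, u] ⬝ᵥ y < ![σ, u] ⬝ᵥ x₁ → g ≤ ![σ, u] ⬝ᵥ x₁ - ![σ, u] ⬝ᵥ y)
    (hΛ : ∀ y ∈ F, |x₁ 1 - y 1| ≤ Λ) (hεΛ : ε * Λ ≤ g / 2) (ht : |t - u| ≤ ε)
    {y : Fin 2 → ℝ} (hy : y ∈ F) (hlt : ![σ, u] ⬝ᵥ y < ![σ, u] ⬝ᵥ x₁) :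
    g / 2 ≤ ![σ, t] ⬝ᵥ x₁ - ![σ, t] ⬝ᵥ y := by
  have haff := chart_dotProduct_sub_affine σ t u x₁ y
  have h1 := hg y hy hlt
  have h2 : |(t - u) * (x₁ 1 - y 1)| ≤ ε * Λ := by
    rw [abs_mul]; exact mul_le_mul ht (hΛ y hy) (abs_nonneg _) ((abs_nonneg _).trans ht)
  have h3 := (abs_le.1 h2).1
  linarith

/-- A UNIQUE maximiser at time `u` (with a positive gap) stays the strict top at every time within `ε` of `u`
(hypotheses of `near_margin`, `g > 0`). [folklore] -/
theorem isStrictTop_near {σ u t ε g Λ : ℝ} {F : Finset (Fin 2 → ℝ)} {x₁ : Fin 2 → ℝ} (hx₁ : x₁ ∈ F)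
    (huniq : ∀ y ∈ F, y ≠ x₁ → ![σ, u] ⬝ᵥ y < ![σ, u] ⬝ᵥ x₁)
    (hg : ∀ y ∈ F, ![σ, u] ⬝ᵥ y < ![σ, u] ⬝ᵥ x₁ → g ≤ ![σ, u] ⬝ᵥ x₁ - ![σ, u] ⬝ᵥ y) (hgpos : 0 < g)
    (hΛ : ∀ y ∈ F, |x₁ 1 - y 1| ≤ Λ) (hεΛ : ε * Λ ≤ g / 2) (ht : |t - u| ≤ ε) :
    IsStrictTop ![σ, t] F x₁ :=
  ⟨hx₁, fun y hy hne => by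
    have := near_margin hg hΛ hεΛ ht hy (huniq y hy hne)
    linarith⟩

/-- **End margin (top).**  If `x⁺` has the largest second coordinate in `F`, smaller second coordinates are smaller by `≥ κ₁ > 0`,
first coordinates differ by `≤ Λ`, and `T ≥ 1 + 2Λ/κ₁`, then at every time `t > T` the point `x⁺` beats every point with a
smaller second coordinate by `≥ t κ₁ / 2` (`σ = ±1`). [folklore] -/
theorem end_margin_top {σ : ℝ} (hσ : σ = 1 ∨ σ = -1) {F : Finset (Fin 2 → ℝ)} {xp : Fin 2 → ℝ} {κ₁ Λ T t : ℝ}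
    (hκ₁ : 0 < κ₁) (hgap : ∀ y ∈ F, y 1 < xp 1 → κ₁ ≤ xp 1 - y 1) (hΛ : ∀ y ∈ F, |xp 0 - y 0| ≤ Λ)
    (hT : 1 + 2 * Λ / κ₁ ≤ T) (ht : T < t) {y : Fin 2 → ℝ} (hy : y ∈ F) (hlt : y 1 < xp 1) :
    t * κ₁ / 2 ≤ ![σ, t] ⬝ᵥ xp - ![σ, t] ⬝ᵥ y := by
  have hσabs : |σ| = 1 := by rcases hσ with h | h <;> simp [h]
  rw [chart_dotProduct, chart_dotProduct]
  have h1 : |σ * (xp 0 - y 0)| ≤ Λ := by rw [abs_mul, hσabs, one_mul]; exact hΛ y hy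
  have h2 := (abs_le.1 h1).1
  have h3 := hgap y hy hlt
  have hΛκ : 2 * Λ ≤ (T - 1) * κ₁ := by
    have := (div_le_iff₀ hκ₁).1 (by linarith : 2 * Λ / κ₁ ≤ T - 1)
    linarith
  have ht0 : 0 < t := by
    have : 0 ≤ 2 * Λ / κ₁ := div_nonneg (by linarith [(abs_nonneg _).trans (hΛ y hy)]) hκ₁.le
    linarith
  nlinarith

/-- **End margin (bottom).**  The mirror statement for `t < -T` and the lowest second coordinate. [folklore] -/
theorem end_margin_bot {σ : ℝ} (hσ : σ = 1 ∨ σ = -1) {F : Finset (Fin 2 → ℝ)} {xm : Fin 2 → ℝ} {κ₁ Λ T t : ℝ}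
    (hκ₁ : 0 < κ₁) (hgap : ∀ y ∈ F, xm 1 < y 1 → κ₁ ≤ y 1 - xm 1) (hΛ : ∀ y ∈ F, |xm 0 - y 0| ≤ Λ)
    (hT : 1 + 2 * Λ / κ₁ ≤ T) (ht : t < -T) {y : Fin 2 → ℝ} (hy : y ∈ F) (hlt : xm 1 < y 1) :
    -t * κ₁ / 2 ≤ ![σ, t] ⬝ᵥ xm - ![σ, t] ⬝ᵥ y := by
  have hσabs : |σ| = 1 := by rcases hσ with h | h <;> simp [h]
  rw [chart_dotProduct, chart_dotProduct]
  have h1 : |σ * (xm 0 - y 0)| ≤ Λ := by rw [abs_mul, hσabs, one_mul]; exact hΛ y hy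
  have h2 := (abs_le.1 h1).1
  have h3 := hgap y hy hlt
  have hΛκ : 2 * Λ ≤ (T - 1) * κ₁ := by
    have := (div_le_iff₀ hκ₁).1 (by linarith : 2 * Λ / κ₁ ≤ T - 1)
    linarith
  have ht0 : 0 < -t := by
    have : 0 ≤ 2 * Λ / κ₁ := div_nonneg (by linarith [(abs_nonneg _).trans (hΛ y hy)]) hκ₁.le
    linarith
  nlinarith

/-! ### A point maximal at two times is the strict top in between -/

/-- If `x ∈ F` maximises the weight at times `e < e''`, then `x` is the strict top at every time strictly in between (the
advantage over any other point is affine, nonnegative at both ends, and not identically zero; `σ ≠ 0`). [folklore] -/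
theorem isStrictTop_between_of_max {σ e e' e'' : ℝ} (hσ : σ ≠ 0) {F : Finset (Fin 2 → ℝ)} {x : Fin 2 → ℝ} (hx : x ∈ F)
    (he : ∀ y ∈ F, ![σ, e] ⬝ᵥ y ≤ ![σ, e] ⬝ᵥ x) (he'' : ∀ y ∈ F, ![σ, e''] ⬝ᵥ y ≤ ![σ, e''] ⬝ᵥ x)
    (h₁ : e < e') (h₂ : e' < e'') : IsStrictTop ![σ, e'] F x := by
  refine ⟨hx, fun y hy hne => ?_⟩
  have a1 := chart_dotProduct_sub_affine σ e' e x y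
  have a2 := chart_dotProduct_sub_affine σ e'' e x y
  have f0 : 0 ≤ ![σ, e] ⬝ᵥ x - ![σ, e] ⬝ᵥ y := sub_nonneg.2 (he y hy)
  have f2 : 0 ≤ ![σ, e''] ⬝ᵥ x - ![σ, e''] ⬝ᵥ y := sub_nonneg.2 (he'' y hy)
  rcases lt_trichotomy (x 1 - y 1) 0 with hd | hd | hd
  · -- decreasing advantage: compare with the later time `e''`
    have : (e'' - e) * (x 1 - y 1) < (e' - e) * (x 1 - y 1) := by nlinarith
    linarith
  · -- constant advantage: zero would force `x = y`
    have hconst : ![σ, e'] ⬝ᵥ x - ![σ, e'] ⬝ᵥ y = ![σ, e] ⬝ᵥ x - ![σ, e] ⬝ᵥ y := by rw [a1, hd, mul_zero, add_zero]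
    rcases lt_or_eq_of_le f0 with hpos | hzero
    · linarith
    · exact absurd (eq_of_chart_eq hσ (by linarith : ![σ, e] ⬝ᵥ x = ![σ, e] ⬝ᵥ y) (sub_eq_zero.1 hd)).symm hne
  · have : 0 < (e' - e) * (x 1 - y 1) := mul_pos (by linarith) hd
    linarith

/-! ### The winning-position inequality for a scaled third curve -/

/-- `|⟨w, p⟩| ≤ (|w₀| + |w₁|)·(|p₀| + |p₁|)`. [folklore] -/
theorem abs_dotProduct_le (w p : Fin 2 → ℝ) : |w ⬝ᵥ p| ≤ (|w 0| + |w 1|) * (|p 0| + |p 1|) := by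
  have h : w ⬝ᵥ p = w 0 * p 0 + w 1 * p 1 := by simp [dotProduct, Fin.sum_univ_two]
  rw [h]
  refine (abs_add_le _ _).trans ?_
  rw [abs_mul, abs_mul]
  nlinarith [abs_nonneg (w 0), abs_nonneg (w 1), abs_nonneg (p 0), abs_nonneg (p 1)]

variable {G : Type*} [AddCommGroup G] [Fintype G]

omit [AddCommGroup G] in
/-- The coordinates of a pair sum are bounded by the `ℓ¹` mass of the two curves. [folklore] -/
theorem abs_pair_coord_le (a b : G → (Fin 2 → ℝ)) (x y : G) (i : Fin 2) :
    |(a x + b y) i| ≤ ∑ u, (|a u 0| + |a u 1|) + ∑ u, (|b u 0| + |b u 1|) := by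
  have ha : |a x i| ≤ ∑ u, (|a u 0| + |a u 1|) := by
    refine le_trans ?_ (Finset.single_le_sum (f := fun u => |a u 0| + |a u 1|) (fun u _ => by positivity)
      (Finset.mem_univ x))
    fin_cases i <;> simp [le_add_iff_nonneg_right, le_add_iff_nonneg_left]
  have hb : |b y i| ≤ ∑ u, (|b u 0| + |b u 1|) := by
    refine le_trans ?_ (Finset.single_le_sum (f := fun u => |b u 0| + |b u 1|) (fun u _ => by positivity)
      (Finset.mem_univ y))
    fin_cases i <;> simp [le_add_iff_nonneg_right, le_add_iff_nonneg_left]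
  rw [Pi.add_apply]
  exact (abs_add_le _ _).trans (add_le_add ha hb)

/-- **Band width bound.**  `bandWidth w a b ≤ (|w₀| + |w₁|) · 4 (∑_x (|a x 0| + |a x 1|) + ∑_y (|b y 0| + |b y 1|))`.
[folklore] -/
theorem bandWidth_le (w : Fin 2 → ℝ) (a b : G → (Fin 2 → ℝ)) :
    bandWidth w a b ≤ (|w 0| + |w 1|) * (4 * (∑ u, (|a u 0| + |a u 1|) + ∑ u, (|b u 0| + |b u 1|))) := by
  set S := ∑ u, (|a u 0| + |a u 1|) + ∑ u, (|b u 0| + |b u 1|) with hS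
  have hS0 : 0 ≤ S := by positivity
  have hN : 0 ≤ |w 0| + |w 1| := by positivity
  -- every pair sum has weight at most `N · 2S`
  have hpt : ∀ x y : G, |w ⬝ᵥ (a x + b y)| ≤ (|w 0| + |w 1|) * (2 * S) := by
    intro x y
    refine (abs_dotProduct_le w _).trans (mul_le_mul_of_nonneg_left ?_ hN)
    have h0 := abs_pair_coord_le a b x y 0
    have h1 := abs_pair_coord_le a b x y 1
    linarith
  -- the top of the band
  have htop : (Finset.univ.sup' univ_nonempty_group fun r : G => fibreSup w a b r) ≤ (|w 0| + |w 1|) * (2 * S) := by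
    refine Finset.sup'_le _ _ fun r _ => ?_
    unfold fibreSup
    refine Finset.sup'_le _ _ fun x _ => ?_
    exact (le_abs_self _).trans (hpt x (r - x))
  -- the mean of the band
  have hq : (1 : ℝ) ≤ Fintype.card G := by exact_mod_cast Fintype.card_pos
  have hmean : |w ⬝ᵥ (∑ x, a x + ∑ y, b y) / Fintype.card G| ≤ (|w 0| + |w 1|) * (2 * S) := by
    rw [abs_div, abs_of_pos (by linarith : (0 : ℝ) < Fintype.card G)]
    refine (div_le_self (abs_nonneg _) hq).trans ?_
    refine (abs_dotProduct_le w _).trans (mul_le_mul_of_nonneg_left ?_ hN)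
    have hc : ∀ i : Fin 2, |(∑ x, a x + ∑ y, b y) i| ≤ S := by
      intro i
      rw [Pi.add_apply, Finset.sum_apply, Finset.sum_apply]
      refine (abs_add_le _ _).trans ?_
      have ha : |∑ x, a x i| ≤ ∑ u, (|a u 0| + |a u 1|) :=
        (Finset.abs_sum_le_sum_abs _ _).trans (Finset.sum_le_sum fun u _ => by
          fin_cases i <;> simp [le_add_iff_nonneg_right, le_add_iff_nonneg_left])
      have hb : |∑ y, b y i| ≤ ∑ u, (|b u 0| + |b u 1|) :=
        (Finset.abs_sum_le_sum_abs _ _).trans (Finset.sum_le_sum fun u _ => by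
          fin_cases i <;> simp [le_add_iff_nonneg_right, le_add_iff_nonneg_left])
      rw [hS]; linarith
    have h0 := hc 0
    have h1 := hc 1
    linarith
  unfold bandWidth
  have := (abs_le.1 hmean).1
  nlinarith

open Classical in
/-- **The winning-position inequality** (from `…TotalsLawShares.Wins.pos_near_top`): an exposed word of the class `r + z` at
position `z` for the third curve `μ • c` forces `μ · (⟨w, c z'⟩ - ⟨w, c z⟩) ≤ bandWidth w a b` for every position `z'`.
[folklore] -/
theorem qual_of_isStrictTop (a b c : G → (Fin 2 → ℝ)) (μ : ℝ) (w : Fin 2 → ℝ) (s r z x : G) (hs : r + z = s)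
    (htop : IsStrictTop w (Finset.univ.image fun p : G × G => a p.1 + b p.2 + (μ • c) (s - p.1 - p.2))
      (a x + b (r - x) + (μ • c) z)) (z' : G) :
    μ * (w ⬝ᵥ c z' - w ⬝ᵥ c z) ≤ bandWidth w a b := by
  have hF : ∀ x' y' : G, a x' + b y' + (μ • c) (r + z - x' - y') ∈
      Finset.univ.image fun p : G × G => a p.1 + b p.2 + (μ • c) (s - p.1 - p.2) :=
    fun x' y' => Finset.mem_image.2 ⟨(x', y'), Finset.mem_univ _, by rw [hs]⟩
  have hw : Wins w a b (μ • c) r z := wins_of_isStrictTop w a b (μ • c) r z x _ hF htop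
  have h := hw.pos_near_top z'
  rw [Pi.smul_apply, Pi.smul_apply, dotProduct_smul, dotProduct_smul, smul_eq_mul, smul_eq_mul] at h
  rw [mul_sub]
  linarith

/-! ### A position is a tied maximiser at no more than two tie times -/

omit [AddCommGroup G] in
open Classical in
/-- **At most two tied times per position.**  If `c z` maximises the weight at three distinct times, it is the strict top at
the middle one; hence the set of times in `E` at which `z` belongs to a maximiser set of size `≥ 2` has at most two elements.
[folklore] -/
theorem card_filter_maxSet_le_two {σ : ℝ} (hσ : σ ≠ 0) (c : G → (Fin 2 → ℝ)) (hc : Function.Injective c) (E : Finset ℝ)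
    (hE : ∀ u ∈ E, 2 ≤ (Finset.univ.filter fun z : G => ∀ z' : G, ![σ, u] ⬝ᵥ c z' ≤ ![σ, u] ⬝ᵥ c z).card) (z : G) :
    (E.filter fun u => ∀ z' : G, ![σ, u] ⬝ᵥ c z' ≤ ![σ, u] ⬝ᵥ c z).card ≤ 2 := by
  classical
  set S := E.filter fun u => ∀ z' : G, ![σ, u] ⬝ᵥ c z' ≤ ![σ, u] ⬝ᵥ c z with hSdef
  by_contra hlt
  push Not at hlt
  have hSne : S.Nonempty := Finset.card_pos.1 (by omega)
  -- a middle element `e'` strictly between `min` and `max`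
  have h1 : ((S.erase (S.min' hSne)).erase (S.max' hSne)).Nonempty := by
    rw [← Finset.card_pos]
    have := Finset.card_erase_add_one (Finset.min'_mem S hSne)
    have h2 : ((S.erase (S.min' hSne)).erase (S.max' hSne)).card + 1 ≥ (S.erase (S.min' hSne)).card := by
      by_cases hm : S.max' hSne ∈ S.erase (S.min' hSne)
      · rw [Finset.card_erase_add_one hm]
      · rw [Finset.erase_eq_of_notMem hm]; omega
    omega
  obtain ⟨e', he'⟩ := h1
  obtain ⟨hne2, he'1⟩ := Finset.mem_erase.1 he'
  obtain ⟨hne1, he'S⟩ := Finset.mem_erase.1 he'1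
  have hlo : S.min' hSne < e' := lt_of_le_of_ne (Finset.min'_le S e' he'S) (Ne.symm hne1)
  have hhi : e' < S.max' hSne := lt_of_le_of_ne (Finset.le_max' S e' he'S) hne2
  have hmin := (Finset.mem_filter.1 (Finset.min'_mem S hSne)).2
  have hmax := (Finset.mem_filter.1 (Finset.max'_mem S hSne)).2
  -- `c z` is the strict top at `e'`
  have hst : IsStrictTop ![σ, e'] (Finset.univ.image c) (c z) :=
    isStrictTop_between_of_max hσ (Finset.mem_image.2 ⟨z, Finset.mem_univ _, rfl⟩)
      (fun y hy => by obtain ⟨z', -, rfl⟩ := Finset.mem_image.1 hy; exact hmin z')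
      (fun y hy => by obtain ⟨z', -, rfl⟩ := Finset.mem_image.1 hy; exact hmax z') hlo hhi
  -- so the maximiser set at `e'` is `{z}`, contradicting `e' ∈ E`
  have hcard : (Finset.univ.filter fun z₁ : G => ∀ z' : G, ![σ, e'] ⬝ᵥ c z' ≤ ![σ, e'] ⬝ᵥ c z₁).card ≤ 1 := by
    refine Finset.card_le_one.2 fun z₁ hz₁ z₂ hz₂ => ?_
    have h₁ := (Finset.mem_filter.1 hz₁).2 z
    have h₂ := (Finset.mem_filter.1 hz₂).2 z
    have k₁ : c z₁ = c z := by
      by_contra hne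
      have := hst.lt (Finset.mem_image.2 ⟨z₁, Finset.mem_univ _, rfl⟩) hne
      linarith
    have k₂ : c z₂ = c z := by
      by_contra hne
      have := hst.lt (Finset.mem_image.2 ⟨z₂, Finset.mem_univ _, rfl⟩) hne
      linarith
    exact hc (k₁.trans k₂.symm)
  have := hE e' (Finset.mem_filter.1 he'S).1
  omega

omit [AddCommGroup G] in
open Classical in
/-- **Tied maximisers are few in total.**  Over the tie times `E` carrying at least two maximising positions,
`∑_{u ∈ E} #maxSet(u) ≤ 2 |G|`. [folklore] -/
theorem sum_card_maxSet_le {σ : ℝ} (hσ : σ ≠ 0) (c : G → (Fin 2 → ℝ)) (hc : Function.Injective c) (E : Finset ℝ)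
    (hE : ∀ u ∈ E, 2 ≤ (Finset.univ.filter fun z : G => ∀ z' : G, ![σ, u] ⬝ᵥ c z' ≤ ![σ, u] ⬝ᵥ c z).card) :
    ∑ u ∈ E, (Finset.univ.filter fun z : G => ∀ z' : G, ![σ, u] ⬝ᵥ c z' ≤ ![σ, u] ⬝ᵥ c z).card ≤
      2 * Fintype.card G := by
  classical
  calc ∑ u ∈ E, (Finset.univ.filter fun z : G => ∀ z' : G, ![σ, u] ⬝ᵥ c z' ≤ ![σ, u] ⬝ᵥ c z).card
      = ∑ u ∈ E, ∑ z : G, (if (∀ z' : G, ![σ, u] ⬝ᵥ c z' ≤ ![σ, u] ⬝ᵥ c z) then 1 else 0) := by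
        refine Finset.sum_congr rfl fun u _ => ?_
        rw [Finset.card_filter]
    _ = ∑ z : G, ∑ u ∈ E, (if (∀ z' : G, ![σ, u] ⬝ᵥ c z' ≤ ![σ, u] ⬝ᵥ c z) then 1 else 0) := Finset.sum_comm
    _ = ∑ z : G, (E.filter fun u => ∀ z' : G, ![σ, u] ⬝ᵥ c z' ≤ ![σ, u] ⬝ᵥ c z).card := by
        refine Finset.sum_congr rfl fun z _ => ?_
        rw [Finset.card_filter]
    _ ≤ ∑ _z : G, 2 := Finset.sum_le_sum fun z _ => card_filter_maxSet_le_two hσ c hc E hE z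
    _ = 2 * Fintype.card G := by rw [Finset.sum_const, Finset.card_univ, smul_eq_mul, mul_comm]

end TotalsLaw

end Summit.ValiantsHypothesis.ValiantsHypothesis.Theorems.NewtonUnitEquationsDissociatedUniform
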